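import Literature.LinearAlgebra.Matrix.MatrixKantorovichInequality
import Literature.LinearAlgebra.Matrix.PositivePairSingularValueInequalities
import Literature.LinearAlgebra.Matrix.HadamardProductSingularValueBounds
import Literature.LinearAlgebra.Matrix.LoewnerEigenvalueBounds
import Literature.LinearAlgebra.Matrix.PositiveMapKadisonChoiInequalities
import HarnessLib

/-!
# The operator Kantorovich inequality for unital positive linear maps `Φ(A⁻¹) ≤ ((M+m)²/(4Mm)) Φ(A)⁻¹`
# (Marshall–Olkin), and Lin's squared version `Φ(A⁻¹)² ≤ ((M+m)²/(4Mm))² Φ(A)⁻²`,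
# `‖Φ(A⁻¹)Φ(A)‖ ≤ (M+m)²/(4Mm)`, `Φ(A⁻¹)Φ(A) + Φ(A)Φ(A⁻¹) ≤ (M+m)²/(2Mm)`

Hodge foundations lane (`lit-hodgefound`, prover p24 gen 62; matrix-analysis series, sequel of
`PositiveMapKadisonChoiInequalities.lean` (Kadison `Φ(A²) ≥ Φ(A)²`, Choi `Φ(A⁻¹) ≥ Φ(A)⁻¹`) and of
`MatrixKantorovichInequality.lean` (the compression case `Φ(X) = V^*XV`, `V^*V = I`)).  THEOREMS ONLY: no definition,
no named fact, net debt 0.  Matrices over `𝕜 = ℝ` or `ℂ` (`[RCLike 𝕜]`); `Y ≤ Z` (Loewner) is `(Z - Y).PosSemidef`;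
real constants are cast into `𝕜`; the operator norm `‖Z‖` is the largest singular value
`(Matrix.toEuclideanLin Z).singularValues 0` (`σ₀`).

## Source, VERBATIM — M. Lin, *On an operator Kantorovich inequality for positive linear maps*, J. Math. Anal. Appl.
402 (2013) 127–132 = arXiv:1212.5690 [Lin2013Kantorovich] (held text `paper:arxiv-1212.5690`, pp. 2–5)

Abstract (p. 2): «We improve the operator Kantorovich inequality as follows: Let `A` be a positive operator on a Hilbert
space with `0 < m ≤ A ≤ M`. Then for every unital positive linear map `Φ`, `Φ(A⁻¹)² ≤ ((M+m)²/(4Mm))² Φ(A)⁻²`. As a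
consequence, `Φ(A⁻¹)Φ(A) + Φ(A)Φ(A⁻¹) ≤ (M+m)²/(2Mm)`.»
§ 1 (p. 3): «Operator version of (1) was firstly established by Marshall & Olkin [MO90], who obtained **Theorem 1.1**
(MO90). Let `0 < m ≤ A ≤ M`. Then for every positive unital linear map `Φ`, `Φ(A⁻¹) ≤ ((M+m)²/(4Mm)) Φ(A)⁻¹`. (2)
The operator Kantorovich inequality (2) can be regarded as a counterpart to Choi's inequality …, which says
`Φ(A⁻¹) ≥ Φ(A)⁻¹`, (3) for every positive unital linear map `Φ` and `A > 0`.»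
§ 2 (p. 4): «There is another way to approach (2). Note that `(M − A)(m − A)A⁻¹ ≤ 0`, then `MmA⁻¹ + A ≤ M + m`, and
hence `MmΦ(A⁻¹) + Φ(A) ≤ M + m`. (6) …  **Proposition 2.4.** Let `0 ≤ A ≤ B` and `0 < m ≤ A ≤ M`. Then
`A² ≤ ((M+m)²/(4Mm))B²`.  …  **Proposition 2.5.** Let `0 < m ≤ A ≤ M`. Then for every positive unital linear map `Φ`,
`Φ(A⁻¹)² ≤ ((M+m)²/(4Mm))³ Φ(A)⁻²`. (7)  *Proof.* As `Φ` is order preserving, then `1/M ≤ Φ(A⁻¹) ≤ 1/m`. By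
Proposition 2.4 … .  **Lemma 2.6** (BK00). Let `A, B ≥ 0`. Then `‖AB‖ ≤ ¼‖A + B‖²`. (8)  …  **Theorem 2.8.** Let
`0 < m ≤ A ≤ M`. Then for every positive unital linear map `Φ`, `‖Φ(A⁻¹)Φ(A)‖ ≤ (M+m)²/(4Mm)`, (9) or equivalently,
`Φ(A⁻¹)² ≤ ((M+m)²/(4Mm))² Φ(A)⁻²`. (10)  *Proof.* By Lemma 2.6, we have
`Mm‖Φ(A⁻¹)Φ(A)‖ = ‖MmΦ(A⁻¹)Φ(A)‖ ≤ ¼‖MmΦ(A⁻¹) + Φ(A)‖² ≤ ¼‖(M+m)I‖² = (M+m)²/4`, where the second inequality is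
by (6). … note that (9) is equivalent to `Φ(A)Φ(A⁻¹)²Φ(A) ≤ ((M+m)²/(4Mm))²`, and hence (10).  **Lemma 2.9.** For any
bounded operator `X`, `|X| ≤ tI ⇔ ‖X‖ ≤ t ⇔ [[tI, X], [X^*, tI]] ≥ 0`.  **Theorem 2.10.** Let `0 < m ≤ A ≤ M`. Then for
every positive unital linear map `Φ`, `|Φ(A⁻¹)Φ(A) + Φ(A)Φ(A⁻¹)| ≤ (M+m)²/(2Mm)` (12) and
`Φ(A⁻¹)Φ(A) + Φ(A)Φ(A⁻¹) ≤ (M+m)²/(2Mm)`. (13)»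

## Dictionary and roads

* `Φ : Matrix n n 𝕜 →ₗ[𝕜] Matrix k k 𝕜` with `hΦ : ∀ X ⪰ 0, Φ X ⪰ 0` (positive) and `hΦ1 : Φ 1 = 1` (unital);
  «`0 < m ≤ A ≤ M`» is `0 < m`, `m ≤ M`, `A − mI ⪰ 0`, `MI − A ⪰ 0` (then `A ≻ 0`, `posDef_of_sub_smul_one`);
  `K = (M+m)²/(4Mm)`; `Φ(A)⁻²` is `(Φ A)⁻¹ ^ 2`.
* (6) is the image under `Φ` of the tree's `A⁻¹ ≤ ((M+m)/(Mm))I − (Mm)⁻¹A` (`MatrixKantorovich.inv_le_of_loewner`,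
  Bernstein Fact 8.9.42); Theorem 1.1 then follows from the tree's `((M+m)/(Mm))I − (Mm)⁻¹C ≤ K·C⁻¹` for EVERY
  `C ≻ 0` (`MatrixKantorovich.affine_le_smul_inv`) with `C = Φ(A)` — the road of [MO90] and of the tree's compression
  file.  Proposition 2.4 is proved directly: `A² ≤ (M+m)A − MmI ≤ (M+m)B − MmI ≤ KB²` (the last gap is
  `(4Mm)⁻¹((M+m)B − 2MmI)²`); Lemma 2.6 is the tree's `four_mul_singularValues_zero_mul_le_sq` (Zhan Thm 4.25);
  Lemma 2.9 `‖X‖ ≤ t ⇒ X^*X ≤ t²I` is the tree's `smul_one_sub_conjTranspose_mul_self_posSemidef`; (12) is stated as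
  `σ₀(Φ(A⁻¹)Φ(A) + Φ(A)Φ(A⁻¹)) ≤ (M+m)²/(2Mm)` (Lemma 2.9: `|X| ≤ tI ⇔ ‖X‖ ≤ t`) and proved by the triangle
  inequality (a shorter road than the printed block-matrix one); (13) from `(KI − Z)^*(KI − Z) ⪰ 0` and `Z^*Z ≤ K²I`.

## What is formalized (all PROVED)

`smul_map_inv_add_map_le` ((6)), **`map_inv_le_smul_inv_map`** (Theorem 1.1, Marshall–Olkin),
`inv_map_le_map_inv_le_smul_inv_map` (Choi's (3) and (2) together, over `ℂ`), **`sq_le_smul_sq_of_le`**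
(Proposition 2.4, Fujii–Izumino–Nakamoto–Seo), `inv_bounds_map_inv` («`1/M ≤ Φ(A⁻¹) ≤ 1/m`»),
`map_inv_sq_le_cube_smul` (Proposition 2.5), **`singularValues_zero_map_inv_mul_map_le`** (Theorem 2.8 (9)),
`map_mul_map_inv_sq_mul_map_le` («`Φ(A)Φ(A⁻¹)²Φ(A) ≤ K²`»), **`map_inv_sq_le_sq_smul`** (Theorem 2.8 (10)),
**`singularValues_zero_anticommutator_le`** (Theorem 2.10 (12)), **`anticommutator_le`** (Theorem 2.10 (13)).
NOT covered: Corollary 2.2 / § 3 (matrix geometric mean `♯`, 2-positive maps).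

## References

* [Lin2013Kantorovich] M. Lin, On an operator Kantorovich inequality for positive linear maps, J. Math. Anal. Appl. 402
  (2013) 127–132; arXiv:1212.5690.
* [MO90] A. W. Marshall, I. Olkin, Matrix versions of the Cauchy and Kantorovich inequalities, Aequationes Math. 40
  (1990) 89–93 (Theorem 1.1).
* [Bernstein2009] D. S. Bernstein, *Matrix Mathematics*, 2nd ed., Fact 8.9.42 (the one-matrix inequality), Fact 9.9.15
  (Lemma 2.6).
* [Zhan2002] X. Zhan, *Matrix Inequalities*, LNM 1790, Theorem 4.25 (Lemma 2.6).
-/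

noncomputable section

open Matrix Finset
open scoped ComplexOrder MatrixOrder
open Literature.LinearAlgebra.Matrix.MatrixKantorovich (inv_le_of_loewner affine_le_smul_inv sq_le_of_eigenvalues_le)
open Literature.LinearAlgebra.Matrix.LoewnerEigenvalueBounds (le_eigenvalues_of_posSemidef eigenvalues_le_of_posSemidef)
open Literature.LinearAlgebra.Matrix.PositivePairSingularValueInequalities (four_mul_singularValues_zero_mul_le_sq)
open Literature.LinearAlgebra.Matrix.HadamardProductSingularValueBounds (smul_one_sub_conjTranspose_mul_self_posSemidef)
open Literature.LinearAlgebra.Matrix.KyFanSingularValueSums (matrix_sum_singularValues_add_le)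

namespace Literature.LinearAlgebra.Matrix.PositiveMapKantorovichInequalities

variable {𝕜 : Type*} [RCLike 𝕜] {n k : Type*} [Fintype n] [DecidableEq n] [Fintype k] [DecidableEq k]

/-! ## § 0. Plumbing -/

section Plumbing

variable {X Y Z : Matrix n n 𝕜}

omit [DecidableEq n] in
/-- `rX ⪰ 0` for a real `r ≥ 0` and `X ⪰ 0`. [folklore] -/
private theorem real_smul_posSemidef {r : ℝ} (hr : 0 ≤ r) (hX : X.PosSemidef) : ((r : 𝕜) • X).PosSemidef := by
  refine PosSemidef.of_dotProduct_mulVec_nonneg ?_ fun x => ?_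
  · unfold Matrix.IsHermitian
    rw [conjTranspose_smul, hX.1.eq, RCLike.star_def, RCLike.conj_ofReal]
  · rw [smul_mulVec, dotProduct_smul, smul_eq_mul]
    exact mul_nonneg (RCLike.ofReal_nonneg.mpr hr) (hX.dotProduct_mulVec_nonneg x)

omit [Fintype n] [DecidableEq n] in
/-- Loewner transitivity. [folklore] -/
private theorem loewner_trans (h₁ : (Y - X).PosSemidef) (h₂ : (Z - Y).PosSemidef) : (Z - X).PosSemidef := by
  have h := h₁.add h₂
  rwa [sub_add_sub_cancel'] at h

omit [Fintype n] in
/-- `cI ≻ 0` for a real `c > 0`. [folklore] -/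
private theorem posDef_real_smul_one {c : ℝ} (hc : 0 < c) : ((c : 𝕜) • (1 : Matrix n n 𝕜)).PosDef := by
  rw [smul_one_eq_diagonal]
  exact posDef_diagonal_iff.mpr fun _ => RCLike.ofReal_pos.mpr hc

omit [Fintype n] in
/-- «`0 < m ≤ A`» gives `A ≻ 0`: `A = (A − mI) + mI`. [cite: Lin2013Kantorovich, § 1 (notation `T > 0`), p. 3] -/
theorem posDef_of_sub_smul_one {A : Matrix n n 𝕜} {m : ℝ} (hm : 0 < m)
    (hmA : (A - (m : 𝕜) • (1 : Matrix n n 𝕜)).PosSemidef) : A.PosDef := by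
  have h := (posDef_real_smul_one (n := n) (𝕜 := 𝕜) hm).posSemidef_add hmA
  simpa using h

omit [Fintype n] in
/-- The Hermitian matrix behind «`m ≤ A`» is Hermitian. [folklore] -/
private theorem isHermitian_of_sub_smul_one {A : Matrix n n 𝕜} {m : ℝ}
    (hmA : (A - (m : 𝕜) • (1 : Matrix n n 𝕜)).PosSemidef) : A.IsHermitian := by
  have h : A = (A - (m : 𝕜) • (1 : Matrix n n 𝕜)) + (m : 𝕜) • (1 : Matrix n n 𝕜) := (sub_add_cancel _ _).symm
  rw [h]
  refine hmA.1.add ?_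
  unfold Matrix.IsHermitian
  rw [conjTranspose_smul, conjTranspose_one, RCLike.star_def, RCLike.conj_ofReal]

end Plumbing

section Maps

variable (Φ : Matrix n n 𝕜 →ₗ[𝕜] Matrix k k 𝕜)

omit [Fintype n] [DecidableEq n] [Fintype k] [DecidableEq k] in
/-- A positive linear map is order preserving: `X ≤ Y ⇒ Φ(X) ≤ Φ(Y)`. [cite: Lin2013Kantorovich, proof of Prop. 2.5
(«As `Φ` is order preserving»), p. 4] -/
theorem map_loewner (hΦ : ∀ X, X.PosSemidef → (Φ X).PosSemidef) {X Y : Matrix n n 𝕜} (h : (Y - X).PosSemidef) :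
    (Φ Y - Φ X).PosSemidef := by
  rw [← map_sub]
  exact hΦ _ h

omit [Fintype n] [Fintype k] in
/-- «`0 < m ≤ A`» and `Φ` unital positive give `Φ(A) ≥ mI`, so `Φ(A) ≻ 0`. [cite: Lin2013Kantorovich, Thm 1.1
(the inverse `Φ(A)⁻¹`), p. 3] -/
theorem posDef_map_of_sub_smul_one (hΦ : ∀ X, X.PosSemidef → (Φ X).PosSemidef) (hΦ1 : Φ 1 = 1) {A : Matrix n n 𝕜}
    {m : ℝ} (hm : 0 < m) (hmA : (A - (m : 𝕜) • (1 : Matrix n n 𝕜)).PosSemidef) : (Φ A).PosDef := by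
  have h := map_loewner Φ hΦ hmA
  rw [map_smul, hΦ1] at h
  exact posDef_of_sub_smul_one hm h

/-! ## § 1. The inequality (6): `MmΦ(A⁻¹) + Φ(A) ≤ (M + m)I` -/

omit [Fintype k] in
/-- The image of Bernstein's Fact 8.9.42 under `Φ`: `Φ(A⁻¹) ≤ ((M+m)/(Mm))I − (Mm)⁻¹Φ(A)` for `0 < m ≤ A ≤ M`.
[cite: Lin2013Kantorovich, (6), p. 4] [cite: Bernstein2009, Fact 8.9.42] -/
theorem map_inv_le_affine (hΦ : ∀ X, X.PosSemidef → (Φ X).PosSemidef) (hΦ1 : Φ 1 = 1) {A : Matrix n n 𝕜}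
    {m M : ℝ} (hm : 0 < m) (hmM : m ≤ M) (hmA : (A - (m : 𝕜) • (1 : Matrix n n 𝕜)).PosSemidef)
    (hAM : ((M : 𝕜) • (1 : Matrix n n 𝕜) - A).PosSemidef) :
    ((((M + m) / (M * m) : ℝ) : 𝕜) • (1 : Matrix k k 𝕜) - (((M * m)⁻¹ : ℝ) : 𝕜) • Φ A - Φ A⁻¹).PosSemidef := by
  have hA : A.PosDef := posDef_of_sub_smul_one hm hmA
  have h0 := inv_le_of_loewner hA hm hmM hmA hAM
  have h1 := hΦ _ h0
  rwa [map_sub, map_sub, map_smul, map_smul, hΦ1] at h1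

/-- **(6): `MmΦ(A⁻¹) + Φ(A) ≤ (M + m)I`** for `0 < m ≤ A ≤ M` and a unital positive linear map `Φ` («Note that
`(M − A)(m − A)A⁻¹ ≤ 0`, then `MmA⁻¹ + A ≤ M + m`, and hence …»). [cite: Lin2013Kantorovich, (6), p. 4] -/
theorem smul_map_inv_add_map_le (hΦ : ∀ X, X.PosSemidef → (Φ X).PosSemidef) (hΦ1 : Φ 1 = 1) {A : Matrix n n 𝕜}
    {m M : ℝ} (hm : 0 < m) (hmM : m ≤ M) (hmA : (A - (m : 𝕜) • (1 : Matrix n n 𝕜)).PosSemidef)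
    (hAM : ((M : 𝕜) • (1 : Matrix n n 𝕜) - A).PosSemidef) :
    (((M + m : ℝ) : 𝕜) • (1 : Matrix k k 𝕜) - (((M * m : ℝ) : 𝕜) • Φ A⁻¹ + Φ A)).PosSemidef := by
  have hMm : 0 < M * m := mul_pos (hm.trans_le hmM) hm
  have h := real_smul_posSemidef hMm.le (map_inv_le_affine Φ hΦ hΦ1 hm hmM hmA hAM)
  rw [smul_sub, smul_sub, smul_smul, smul_smul, ← RCLike.ofReal_mul, ← RCLike.ofReal_mul,
    mul_div_cancel₀ _ hMm.ne', mul_inv_cancel₀ hMm.ne', RCLike.ofReal_one, one_smul] at h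
  convert h using 1
  abel

/-! ## § 2. Theorem 1.1 (Marshall–Olkin 1990): `Φ(A⁻¹) ≤ ((M+m)²/(4Mm)) Φ(A)⁻¹` -/

/-- **Theorem 1.1 (Marshall–Olkin [MO90]), the operator Kantorovich inequality: `Φ(A⁻¹) ≤ ((M+m)²/(4Mm)) Φ(A)⁻¹`**
for `0 < m ≤ A ≤ M` and every positive unital linear map `Φ` (here between matrix algebras).
[cite: Lin2013Kantorovich, Theorem 1.1 (2), p. 3] -/
theorem map_inv_le_smul_inv_map (hΦ : ∀ X, X.PosSemidef → (Φ X).PosSemidef) (hΦ1 : Φ 1 = 1) {A : Matrix n n 𝕜}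
    {m M : ℝ} (hm : 0 < m) (hmM : m ≤ M) (hmA : (A - (m : 𝕜) • (1 : Matrix n n 𝕜)).PosSemidef)
    (hAM : ((M : 𝕜) • (1 : Matrix n n 𝕜) - A).PosSemidef) :
    ((((M + m) ^ 2 / (4 * (M * m)) : ℝ) : 𝕜) • (Φ A)⁻¹ - Φ A⁻¹).PosSemidef := by
  have hMm : 0 < M * m := mul_pos (hm.trans_le hmM) hm
  have h1 := map_inv_le_affine Φ hΦ hΦ1 hm hmM hmA hAM
  have h2 := affine_le_smul_inv (posDef_map_of_sub_smul_one Φ hΦ hΦ1 hm hmA) hMm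
  exact loewner_trans (by simpa [sub_sub] using h1) h2

/-! ## § 3. Proposition 2.4 (Fujii–Izumino–Nakamoto–Seo): `0 ≤ A ≤ B`, `m ≤ A ≤ M` ⇒ `A² ≤ ((M+m)²/(4Mm))B²` -/

omit [DecidableEq n] in
/-- The square of a Hermitian matrix is `⪰ 0`. [folklore] -/
private theorem posSemidef_mul_self {H : Matrix n n 𝕜} (hH : H.IsHermitian) : (H * H).PosSemidef := by
  have h := posSemidef_conjTranspose_mul_self H
  rwa [hH.eq] at h

/-- `(M+m)B − MmI ≤ ((M+m)²/(4Mm))B²` for every Hermitian `B` and `Mm > 0`: the gap is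
`(4Mm)⁻¹((M+m)B − 2MmI)²`. [cite: Lin2013Kantorovich, Prop. 2.4 (proof road), p. 4] -/
theorem affine_le_smul_sq {B : Matrix n n 𝕜} (hB : B.IsHermitian) {m M : ℝ} (hMm : 0 < M * m) :
    ((((M + m) ^ 2 / (4 * (M * m)) : ℝ) : 𝕜) • B ^ 2 -
      (((M + m : ℝ) : 𝕜) • B - ((M * m : ℝ) : 𝕜) • (1 : Matrix n n 𝕜))).PosSemidef := by
  have h4 : 0 < 4 * (M * m) := by positivity
  have hH : (((M + m : ℝ) : 𝕜) • B - ((2 * (M * m) : ℝ) : 𝕜) • (1 : Matrix n n 𝕜)).IsHermitian := by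
    unfold Matrix.IsHermitian
    rw [conjTranspose_sub, conjTranspose_smul, conjTranspose_smul, conjTranspose_one, hB.eq]
    simp
  have hX := posSemidef_mul_self hH
  have hK4 : 4 * (M * m) * ((M + m) ^ 2 / (4 * (M * m))) = (M + m) ^ 2 := by
    rw [mul_comm]
    exact div_mul_cancel₀ _ h4.ne'
  have e : ((4 * (M * m) : ℝ) : 𝕜) • ((((M + m) ^ 2 / (4 * (M * m)) : ℝ) : 𝕜) • B ^ 2 -
      (((M + m : ℝ) : 𝕜) • B - ((M * m : ℝ) : 𝕜) • (1 : Matrix n n 𝕜))) =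
      (((M + m : ℝ) : 𝕜) • B - ((2 * (M * m) : ℝ) : 𝕜) • (1 : Matrix n n 𝕜)) *
        (((M + m : ℝ) : 𝕜) • B - ((2 * (M * m) : ℝ) : 𝕜) • (1 : Matrix n n 𝕜)) := by
    rw [smul_sub, smul_smul, ← RCLike.ofReal_mul, hK4]
    simp only [Matrix.sub_mul, Matrix.mul_sub, Matrix.smul_mul, Matrix.mul_smul, Matrix.one_mul, Matrix.mul_one,
      smul_sub, smul_smul, pow_two]
    push_cast
    module
  have h := real_smul_posSemidef (inv_nonneg.mpr h4.le) hX
  rwa [← e, smul_smul, ← RCLike.ofReal_mul, inv_mul_cancel₀ h4.ne', RCLike.ofReal_one, one_smul] at h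

/-- **Proposition 2.4 (Fujii et al. [FINS97]): `0 ≤ A ≤ B` and `0 < m ≤ A ≤ M` give `A² ≤ ((M+m)²/(4Mm))B²`**
(«`t²` is order preserving in the following sense»).  Road: `A² ≤ (M+m)A − MmI` (`(MI − A)(A − mI) ⪰ 0`, commuting
factors), `≤ (M+m)B − MmI` (`A ≤ B`), `≤ ((M+m)²/(4Mm))B²` (`affine_le_smul_sq`). [cite: Lin2013Kantorovich,
Proposition 2.4, p. 4] -/
theorem sq_le_smul_sq_of_le {A B : Matrix n n 𝕜} {m M : ℝ} (hm : 0 < m) (hmM : m ≤ M)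
    (hmA : (A - (m : 𝕜) • (1 : Matrix n n 𝕜)).PosSemidef) (hAM : ((M : 𝕜) • (1 : Matrix n n 𝕜) - A).PosSemidef)
    (hAB : (B - A).PosSemidef) :
    ((((M + m) ^ 2 / (4 * (M * m)) : ℝ) : 𝕜) • B ^ 2 - A ^ 2).PosSemidef := by
  have hMm : 0 < M * m := mul_pos (hm.trans_le hmM) hm
  have hA : A.IsHermitian := isHermitian_of_sub_smul_one hmA
  have hB : B.IsHermitian := by
    have h := hAB.1.add hA
    rwa [sub_add_cancel] at h
  -- `A² ≤ (M+m)A − MmI`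
  have h1 := sq_le_of_eigenvalues_le hA (le_eigenvalues_of_posSemidef hA hmA) (eigenvalues_le_of_posSemidef hA hAM)
  -- `(M+m)A − MmI ≤ (M+m)B − MmI`
  have h2 : ((((M + m : ℝ) : 𝕜) • B - ((M * m : ℝ) : 𝕜) • (1 : Matrix n n 𝕜)) -
      (((M + m : ℝ) : 𝕜) • A - ((M * m : ℝ) : 𝕜) • (1 : Matrix n n 𝕜))).PosSemidef := by
    have h := real_smul_posSemidef (add_pos (hm.trans_le hmM) hm).le hAB
    rw [smul_sub] at h
    convert h using 1
    abel
  exact loewner_trans (loewner_trans h1 h2) (affine_le_smul_sq hB hMm)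

/-! ## § 4. Proposition 2.5: `Φ(A⁻¹)² ≤ ((M+m)²/(4Mm))³ Φ(A)⁻²` -/

/-- «`1/M ≤ A⁻¹ ≤ 1/m`» for `0 < m ≤ A ≤ M`: `m⁻¹I − A⁻¹ = m⁻¹A⁻¹(A − mI)` and `A⁻¹ − M⁻¹I = M⁻¹A⁻¹(MI − A)` are
products of commuting positive semidefinite matrices. [cite: Lin2013Kantorovich, proof of Prop. 2.5, p. 4] -/
theorem inv_bounds {A : Matrix n n 𝕜} {m M : ℝ} (hm : 0 < m) (hmM : m ≤ M)
    (hmA : (A - (m : 𝕜) • (1 : Matrix n n 𝕜)).PosSemidef) (hAM : ((M : 𝕜) • (1 : Matrix n n 𝕜) - A).PosSemidef) :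
    (A⁻¹ - ((M⁻¹ : ℝ) : 𝕜) • (1 : Matrix n n 𝕜)).PosSemidef ∧
      (((m⁻¹ : ℝ) : 𝕜) • (1 : Matrix n n 𝕜) - A⁻¹).PosSemidef := by
  have hM : 0 < M := hm.trans_le hmM
  have hA : A.PosDef := posDef_of_sub_smul_one hm hmA
  have hAu : IsUnit A.det := isUnit_iff_ne_zero.mpr hA.det_pos.ne'
  have h1 : A⁻¹ * A = 1 := nonsing_inv_mul A hAu
  have h2 : A * A⁻¹ = 1 := mul_nonsing_inv A hAu
  have hi : A⁻¹.PosSemidef := hA.inv.posSemidef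
  constructor
  · have hc : Commute (((M⁻¹ : ℝ) : 𝕜) • A⁻¹) ((M : 𝕜) • (1 : Matrix n n 𝕜) - A) := by
      unfold Commute SemiconjBy
      simp only [Matrix.sub_mul, Matrix.mul_sub, Matrix.smul_mul, Matrix.mul_smul, Matrix.one_mul, Matrix.mul_one,
        h1, h2]
      module
    have h := posSemidef_mul_of_posSemidef_of_commute (real_smul_posSemidef (inv_nonneg.mpr hM.le) hi) hAM hc
    have e : (((M⁻¹ : ℝ) : 𝕜) • A⁻¹) * ((M : 𝕜) • (1 : Matrix n n 𝕜) - A) =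
        A⁻¹ - ((M⁻¹ : ℝ) : 𝕜) • (1 : Matrix n n 𝕜) := by
      rw [Matrix.mul_sub, Matrix.smul_mul, Matrix.smul_mul, Matrix.mul_smul, Matrix.mul_one, h1, smul_smul,
        ← RCLike.ofReal_mul, inv_mul_cancel₀ hM.ne', RCLike.ofReal_one, one_smul]
    rwa [e] at h
  · have hc : Commute (((m⁻¹ : ℝ) : 𝕜) • A⁻¹) (A - (m : 𝕜) • (1 : Matrix n n 𝕜)) := by
      unfold Commute SemiconjBy
      simp only [Matrix.sub_mul, Matrix.mul_sub, Matrix.smul_mul, Matrix.mul_smul, Matrix.one_mul, Matrix.mul_one,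
        h1, h2]
      module
    have h := posSemidef_mul_of_posSemidef_of_commute (real_smul_posSemidef (inv_nonneg.mpr hm.le) hi) hmA hc
    have e : (((m⁻¹ : ℝ) : 𝕜) • A⁻¹) * (A - (m : 𝕜) • (1 : Matrix n n 𝕜)) =
        ((m⁻¹ : ℝ) : 𝕜) • (1 : Matrix n n 𝕜) - A⁻¹ := by
      rw [Matrix.mul_sub, Matrix.smul_mul, Matrix.smul_mul, Matrix.mul_smul, Matrix.mul_one, h1, smul_smul,
        ← RCLike.ofReal_mul, inv_mul_cancel₀ hm.ne', RCLike.ofReal_one, one_smul]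
    rwa [e] at h

omit [Fintype k] in
/-- «As `Φ` is order preserving, then `1/M ≤ Φ(A⁻¹) ≤ 1/m`» for `0 < m ≤ A ≤ M` and `Φ` unital positive.
[cite: Lin2013Kantorovich, proof of Prop. 2.5, p. 4] -/
theorem inv_bounds_map_inv (hΦ : ∀ X, X.PosSemidef → (Φ X).PosSemidef) (hΦ1 : Φ 1 = 1) {A : Matrix n n 𝕜}
    {m M : ℝ} (hm : 0 < m) (hmM : m ≤ M) (hmA : (A - (m : 𝕜) • (1 : Matrix n n 𝕜)).PosSemidef)
    (hAM : ((M : 𝕜) • (1 : Matrix n n 𝕜) - A).PosSemidef) :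
    (Φ A⁻¹ - ((M⁻¹ : ℝ) : 𝕜) • (1 : Matrix k k 𝕜)).PosSemidef ∧
      (((m⁻¹ : ℝ) : 𝕜) • (1 : Matrix k k 𝕜) - Φ A⁻¹).PosSemidef := by
  obtain ⟨h1, h2⟩ := inv_bounds hm hmM hmA hAM
  refine ⟨?_, ?_⟩
  · have h := map_loewner Φ hΦ h1
    rwa [map_smul, hΦ1] at h
  · have h := map_loewner Φ hΦ h2
    rwa [map_smul, hΦ1] at h

/-- **Proposition 2.5: `Φ(A⁻¹)² ≤ ((M+m)²/(4Mm))³ Φ(A)⁻²`** for `0 < m ≤ A ≤ M` and `Φ` unital positive (Proposition 2.4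
applied to `1/M ≤ Φ(A⁻¹) ≤ 1/m` and `Φ(A⁻¹) ≤ K Φ(A)⁻¹`: the Kantorovich constant of `[1/M, 1/m]` is again `K`).
[cite: Lin2013Kantorovich, Proposition 2.5 (7), p. 4] -/
theorem map_inv_sq_le_cube_smul (hΦ : ∀ X, X.PosSemidef → (Φ X).PosSemidef) (hΦ1 : Φ 1 = 1) {A : Matrix n n 𝕜}
    {m M : ℝ} (hm : 0 < m) (hmM : m ≤ M) (hmA : (A - (m : 𝕜) • (1 : Matrix n n 𝕜)).PosSemidef)
    (hAM : ((M : 𝕜) • (1 : Matrix n n 𝕜) - A).PosSemidef) :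
    (((((M + m) ^ 2 / (4 * (M * m))) ^ 3 : ℝ) : 𝕜) • (Φ A)⁻¹ ^ 2 - (Φ A⁻¹) ^ 2).PosSemidef := by
  have hM : 0 < M := hm.trans_le hmM
  have hMm : 0 < M * m := mul_pos hM hm
  obtain ⟨h1, h2⟩ := inv_bounds_map_inv Φ hΦ hΦ1 hm hmM hmA hAM
  have h3 := map_inv_le_smul_inv_map Φ hΦ hΦ1 hm hmM hmA hAM
  have h := sq_le_smul_sq_of_le (inv_pos.mpr hM) (inv_anti₀ hm hmM) h1 h2 h3
  have hK : (m⁻¹ + M⁻¹) ^ 2 / (4 * (m⁻¹ * M⁻¹)) = (M + m) ^ 2 / (4 * (M * m)) := by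
    field_simp
  rw [hK, smul_pow, smul_smul, ← RCLike.ofReal_pow, ← RCLike.ofReal_mul] at h
  convert h using 3
  push_cast
  ring

/-! ## § 5. Theorem 2.8 (Lin): `‖Φ(A⁻¹)Φ(A)‖ ≤ (M+m)²/(4Mm)` and `Φ(A⁻¹)² ≤ ((M+m)²/(4Mm))² Φ(A)⁻²` -/

omit [DecidableEq k] in
/-- `σ₀(Z) ≤ c` for `0 ≤ Z ≤ cI` (the largest singular value of `Z ⪰ 0` is its largest eigenvalue).
[cite: Lin2013Kantorovich, proof of Thm 2.8 («`≤ ¼‖(M+m)I‖²`»), p. 4] -/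
theorem singularValues_zero_le_of_le_smul_one [DecidableEq k] {Z : Matrix k k 𝕜} (hZ : Z.PosSemidef) {c : ℝ}
    (hc : 0 ≤ c) (hZc : ((c : 𝕜) • (1 : Matrix k k 𝕜) - Z).PosSemidef) :
    (Matrix.toEuclideanLin Z).singularValues 0 ≤ c := by
  rcases isEmpty_or_nonempty k with hk | hk
  · rw [singularValues_toEuclideanLin_of_card_le Z (by simp)]
    exact hc
  · have h0 : 0 < Fintype.card k := Fintype.card_pos
    rw [show (0 : ℕ) = ((⟨0, h0⟩ : Fin (Fintype.card k)) : ℕ) from rfl,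
      Literature.LinearAlgebra.Matrix.singularValues_eq_eigenvalues₀_of_posSemidef hZ ⟨0, h0⟩]
    have he : hZ.isHermitian.eigenvalues₀ ⟨0, h0⟩ =
        hZ.isHermitian.eigenvalues (Fintype.equivOfCardEq (Fintype.card_fin _) ⟨0, h0⟩) := by
      simp only [Matrix.IsHermitian.eigenvalues, Equiv.symm_apply_apply]
    rw [he]
    exact eigenvalues_le_of_posSemidef hZ.isHermitian hZc _

/-- **Theorem 2.8 (9): `‖Φ(A⁻¹)Φ(A)‖ ≤ (M+m)²/(4Mm)`** (operator norm = largest singular value `σ₀`), for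
`0 < m ≤ A ≤ M` and `Φ` unital positive: `Mm‖Φ(A⁻¹)Φ(A)‖ ≤ ¼‖MmΦ(A⁻¹) + Φ(A)‖² ≤ ¼(M+m)²` by Lemma 2.6
(Bhatia–Kittaneh, the tree's `four_mul_singularValues_zero_mul_le_sq`) and (6). [cite: Lin2013Kantorovich,
Theorem 2.8 (9) and its proof, p. 4] -/
theorem singularValues_zero_map_inv_mul_map_le (hΦ : ∀ X, X.PosSemidef → (Φ X).PosSemidef) (hΦ1 : Φ 1 = 1)
    {A : Matrix n n 𝕜} {m M : ℝ} (hm : 0 < m) (hmM : m ≤ M) (hmA : (A - (m : 𝕜) • (1 : Matrix n n 𝕜)).PosSemidef)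
    (hAM : ((M : 𝕜) • (1 : Matrix n n 𝕜) - A).PosSemidef) :
    (Matrix.toEuclideanLin (Φ A⁻¹ * Φ A)).singularValues 0 ≤ (M + m) ^ 2 / (4 * (M * m)) := by
  have hM : 0 < M := hm.trans_le hmM
  have hMm : 0 < M * m := mul_pos hM hm
  have hA : A.PosDef := posDef_of_sub_smul_one hm hmA
  have hX : (((M * m : ℝ) : 𝕜) • Φ A⁻¹).PosSemidef := real_smul_posSemidef hMm.le (hΦ _ hA.inv.posSemidef)
  have hY : (Φ A).PosSemidef := hΦ _ hA.posSemidef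
  have h1 := four_mul_singularValues_zero_mul_le_sq hX hY
  have h2 : (Matrix.toEuclideanLin (((M * m : ℝ) : 𝕜) • Φ A⁻¹ + Φ A)).singularValues 0 ≤ M + m :=
    singularValues_zero_le_of_le_smul_one (hX.add hY) (add_pos hM hm).le
      (smul_map_inv_add_map_le Φ hΦ hΦ1 hm hmM hmA hAM)
  rw [Matrix.smul_mul, singularValues_toEuclideanLin_smul, RCLike.norm_ofReal, abs_of_pos hMm] at h1
  have h3 : 4 * (M * m * (Matrix.toEuclideanLin (Φ A⁻¹ * Φ A)).singularValues 0) ≤ (M + m) ^ 2 :=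
    h1.trans (pow_le_pow_left₀ (LinearMap.singularValues_nonneg _ _) h2 2)
  rw [le_div_iff₀ (by positivity)]
  linarith

/-- **`Φ(A)Φ(A⁻¹)²Φ(A) ≤ ((M+m)²/(4Mm))²`** (the form of (9) through Lemma 2.9: `‖X‖ ≤ t ⇔ X^*X ≤ t²I`, here with
`X = Φ(A⁻¹)Φ(A)`, `X^*X = Φ(A)Φ(A⁻¹)²Φ(A)`). [cite: Lin2013Kantorovich, proof of Thm 2.8 («(9) is equivalent to
`Φ(A)Φ(A⁻¹)²Φ(A) ≤ ((M+m)²/(4Mm))²`»), p. 4; Lemma 2.9] -/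
theorem map_mul_map_inv_sq_mul_map_le (hΦ : ∀ X, X.PosSemidef → (Φ X).PosSemidef) (hΦ1 : Φ 1 = 1)
    {A : Matrix n n 𝕜} {m M : ℝ} (hm : 0 < m) (hmM : m ≤ M) (hmA : (A - (m : 𝕜) • (1 : Matrix n n 𝕜)).PosSemidef)
    (hAM : ((M : 𝕜) • (1 : Matrix n n 𝕜) - A).PosSemidef) :
    (((((M + m) ^ 2 / (4 * (M * m))) ^ 2 : ℝ) : 𝕜) • (1 : Matrix k k 𝕜) -
      Φ A * (Φ A⁻¹) ^ 2 * Φ A).PosSemidef := by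
  have hA : A.PosDef := posDef_of_sub_smul_one hm hmA
  have hXh : (Φ A⁻¹).IsHermitian := (hΦ _ hA.inv.posSemidef).isHermitian
  have hYh : (Φ A).IsHermitian := (hΦ _ hA.posSemidef).isHermitian
  have h1 := smul_one_sub_conjTranspose_mul_self_posSemidef (Φ A⁻¹ * Φ A)
  have hσ := singularValues_zero_map_inv_mul_map_le Φ hΦ hΦ1 hm hmM hmA hAM
  have hσ0 : 0 ≤ (Matrix.toEuclideanLin (Φ A⁻¹ * Φ A)).singularValues 0 := LinearMap.singularValues_nonneg _ _
  have h2 : ((((((M + m) ^ 2 / (4 * (M * m))) ^ 2 : ℝ) : 𝕜) • (1 : Matrix k k 𝕜)) -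
      (((Matrix.toEuclideanLin (Φ A⁻¹ * Φ A)).singularValues 0 ^ 2 : ℝ) : 𝕜) • (1 : Matrix k k 𝕜)).PosSemidef := by
    rw [← sub_smul, ← RCLike.ofReal_sub]
    exact real_smul_posSemidef (sub_nonneg.mpr (pow_le_pow_left₀ hσ0 hσ 2)) PosSemidef.one
  have h := loewner_trans h1 h2
  rw [conjTranspose_mul, hXh.eq, hYh.eq, Matrix.mul_assoc] at h
  rw [pow_two (Φ A⁻¹), Matrix.mul_assoc, Matrix.mul_assoc]
  exact h

/-- **Theorem 2.8 (10) (Lin): `Φ(A⁻¹)² ≤ ((M+m)²/(4Mm))² Φ(A)⁻²`** for `0 < m ≤ A ≤ M` and `Φ` unital positive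
(`Φ(A)⁻²` written `(Φ A)⁻¹ ^ 2`; conjugate `Φ(A)Φ(A⁻¹)²Φ(A) ≤ K²I` by `Φ(A)⁻¹`). [cite: Lin2013Kantorovich, Theorem 2.8
(10), Abstract, pp. 2, 4] -/
theorem map_inv_sq_le_sq_smul (hΦ : ∀ X, X.PosSemidef → (Φ X).PosSemidef) (hΦ1 : Φ 1 = 1) {A : Matrix n n 𝕜}
    {m M : ℝ} (hm : 0 < m) (hmM : m ≤ M) (hmA : (A - (m : 𝕜) • (1 : Matrix n n 𝕜)).PosSemidef)
    (hAM : ((M : 𝕜) • (1 : Matrix n n 𝕜) - A).PosSemidef) :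
    (((((M + m) ^ 2 / (4 * (M * m))) ^ 2 : ℝ) : 𝕜) • (Φ A)⁻¹ ^ 2 - (Φ A⁻¹) ^ 2).PosSemidef := by
  have hY : (Φ A).PosDef := posDef_map_of_sub_smul_one Φ hΦ hΦ1 hm hmA
  have hYu : IsUnit (Φ A).det := isUnit_iff_ne_zero.mpr hY.det_pos.ne'
  have h1 : (Φ A)⁻¹ * Φ A = 1 := nonsing_inv_mul _ hYu
  have h2 : Φ A * (Φ A)⁻¹ = 1 := mul_nonsing_inv _ hYu
  have h := (map_mul_map_inv_sq_mul_map_le Φ hΦ hΦ1 hm hmM hmA hAM).conjTranspose_mul_mul_same (Φ A)⁻¹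
  rwa [hY.inv.1.eq, Matrix.mul_sub, Matrix.sub_mul, Matrix.mul_smul, Matrix.mul_one, Matrix.smul_mul,
    ← Matrix.mul_assoc, ← Matrix.mul_assoc, h1, Matrix.one_mul, Matrix.mul_assoc (Φ A⁻¹ ^ 2), h2, Matrix.mul_one,
    ← pow_two] at h

/-! ## § 6. Theorem 2.10: the anticommutator `Φ(A⁻¹)Φ(A) + Φ(A)Φ(A⁻¹)` -/

/-- **Theorem 2.10 (12): `|Φ(A⁻¹)Φ(A) + Φ(A)Φ(A⁻¹)| ≤ (M+m)²/(2Mm)`**, stated through Lemma 2.9 (`|X| ≤ tI ⇔ ‖X‖ ≤ t`)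
as `σ₀(Φ(A⁻¹)Φ(A) + Φ(A)Φ(A⁻¹)) ≤ (M+m)²/(2Mm)`; proved from (9) by the triangle inequality and
`σ₀(X^*) = σ₀(X)` (a shorter road than the printed one). [cite: Lin2013Kantorovich, Theorem 2.10 (12), Lemma 2.9,
pp. 4–5] -/
theorem singularValues_zero_anticommutator_le (hΦ : ∀ X, X.PosSemidef → (Φ X).PosSemidef) (hΦ1 : Φ 1 = 1)
    {A : Matrix n n 𝕜} {m M : ℝ} (hm : 0 < m) (hmM : m ≤ M) (hmA : (A - (m : 𝕜) • (1 : Matrix n n 𝕜)).PosSemidef)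
    (hAM : ((M : 𝕜) • (1 : Matrix n n 𝕜) - A).PosSemidef) :
    (Matrix.toEuclideanLin (Φ A⁻¹ * Φ A + Φ A * Φ A⁻¹)).singularValues 0 ≤ (M + m) ^ 2 / (2 * (M * m)) := by
  have hA : A.PosDef := posDef_of_sub_smul_one hm hmA
  have hXh : (Φ A⁻¹).IsHermitian := (hΦ _ hA.inv.posSemidef).isHermitian
  have hYh : (Φ A).IsHermitian := (hΦ _ hA.posSemidef).isHermitian
  have hσ := singularValues_zero_map_inv_mul_map_le Φ hΦ hΦ1 hm hmM hmA hAM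
  have hT := matrix_sum_singularValues_add_le (Φ A⁻¹ * Φ A) (Φ A * Φ A⁻¹) 1
  simp only [sum_range_one] at hT
  have hadj : Φ A * Φ A⁻¹ = (Φ A⁻¹ * Φ A)ᴴ := by rw [conjTranspose_mul, hXh.eq, hYh.eq]
  rw [hadj, singularValues_toEuclideanLin_conjTranspose] at hT
  rw [hadj]
  have e : (M + m) ^ 2 / (2 * (M * m)) = 2 * ((M + m) ^ 2 / (4 * (M * m))) := by ring
  rw [e]
  linarith

/-- `2tI − (Z + Z^*) ⪰ 0` when `Z^*Z ≤ t²I` and `t > 0` (`(tI − Z)^*(tI − Z) ⪰ 0`). [cite: Lin2013Kantorovich, Lemma 2.9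
and the proof of Thm 2.10, pp. 4–5] -/
theorem two_smul_one_sub_add_conjTranspose_posSemidef {Z : Matrix k k 𝕜} {t : ℝ} (ht : 0 < t)
    (hZ : (((t ^ 2 : ℝ) : 𝕜) • (1 : Matrix k k 𝕜) - Zᴴ * Z).PosSemidef) :
    (((2 * t : ℝ) : 𝕜) • (1 : Matrix k k 𝕜) - (Z + Zᴴ)).PosSemidef := by
  have h1 := posSemidef_conjTranspose_mul_self ((t : 𝕜) • (1 : Matrix k k 𝕜) - Z)
  have e : ((t : 𝕜) • (1 : Matrix k k 𝕜) - Z)ᴴ * ((t : 𝕜) • (1 : Matrix k k 𝕜) - Z) =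
      ((t ^ 2 : ℝ) : 𝕜) • (1 : Matrix k k 𝕜) - (t : 𝕜) • (Z + Zᴴ) + Zᴴ * Z := by
    rw [conjTranspose_sub, conjTranspose_smul, conjTranspose_one, RCLike.star_def, RCLike.conj_ofReal]
    simp only [Matrix.sub_mul, Matrix.mul_sub, Matrix.smul_mul, Matrix.mul_smul, Matrix.one_mul, Matrix.mul_one,
      smul_add]
    push_cast
    module
  rw [e] at h1
  have h2 := h1.add hZ
  have e2 : ((t ^ 2 : ℝ) : 𝕜) • (1 : Matrix k k 𝕜) - (t : 𝕜) • (Z + Zᴴ) + Zᴴ * Z +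
      (((t ^ 2 : ℝ) : 𝕜) • (1 : Matrix k k 𝕜) - Zᴴ * Z) = (t : 𝕜) • (((2 * t : ℝ) : 𝕜) • (1 : Matrix k k 𝕜) - (Z + Zᴴ)) := by
    simp only [smul_sub, smul_smul]
    push_cast
    module
  rw [e2] at h2
  have h3 := real_smul_posSemidef (inv_nonneg.mpr ht.le) h2
  rwa [smul_smul, ← RCLike.ofReal_mul, inv_mul_cancel₀ ht.ne', RCLike.ofReal_one, one_smul] at h3

/-- **Theorem 2.10 (13): `Φ(A⁻¹)Φ(A) + Φ(A)Φ(A⁻¹) ≤ (M+m)²/(2Mm)`** for `0 < m ≤ A ≤ M` and `Φ` unital positive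
(«As `Φ(A⁻¹)` and `Φ(A)` do not commute generally, `Φ(A⁻¹)Φ(A) + Φ(A)Φ(A⁻¹)` need not be positive»).
[cite: Lin2013Kantorovich, Theorem 2.10 (13), Abstract, pp. 2, 4–5] -/
theorem anticommutator_le (hΦ : ∀ X, X.PosSemidef → (Φ X).PosSemidef) (hΦ1 : Φ 1 = 1) {A : Matrix n n 𝕜}
    {m M : ℝ} (hm : 0 < m) (hmM : m ≤ M) (hmA : (A - (m : 𝕜) • (1 : Matrix n n 𝕜)).PosSemidef)
    (hAM : ((M : 𝕜) • (1 : Matrix n n 𝕜) - A).PosSemidef) :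
    ((((M + m) ^ 2 / (2 * (M * m)) : ℝ) : 𝕜) • (1 : Matrix k k 𝕜) - (Φ A⁻¹ * Φ A + Φ A * Φ A⁻¹)).PosSemidef := by
  have hM : 0 < M := hm.trans_le hmM
  have hMm : 0 < M * m := mul_pos hM hm
  have hA : A.PosDef := posDef_of_sub_smul_one hm hmA
  have hXh : (Φ A⁻¹).IsHermitian := (hΦ _ hA.inv.posSemidef).isHermitian
  have hYh : (Φ A).IsHermitian := (hΦ _ hA.posSemidef).isHermitian
  have hK : 0 < (M + m) ^ 2 / (4 * (M * m)) := by positivity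
  have h1 := map_mul_map_inv_sq_mul_map_le Φ hΦ hΦ1 hm hmM hmA hAM
  have hZZ : (Φ A⁻¹ * Φ A)ᴴ * (Φ A⁻¹ * Φ A) = Φ A * (Φ A⁻¹) ^ 2 * Φ A := by
    rw [conjTranspose_mul, hXh.eq, hYh.eq, pow_two, ← Matrix.mul_assoc, Matrix.mul_assoc (Φ A) (Φ A⁻¹)]
  rw [← hZZ] at h1
  have h := two_smul_one_sub_add_conjTranspose_posSemidef hK h1
  have hadj : (Φ A⁻¹ * Φ A)ᴴ = Φ A * Φ A⁻¹ := by rw [conjTranspose_mul, hXh.eq, hYh.eq]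
  have e : 2 * ((M + m) ^ 2 / (4 * (M * m))) = (M + m) ^ 2 / (2 * (M * m)) := by ring
  rwa [hadj, e] at h

end Maps

/-! ## § 7. Choi's (3) and Marshall–Olkin's (2) together, over `ℂ`: `Φ(A)⁻¹ ≤ Φ(A⁻¹) ≤ ((M+m)²/(4Mm)) Φ(A)⁻¹` -/

section Complex

variable {n k : Type*} [Fintype n] [DecidableEq n] [Fintype k] [DecidableEq k]
  (Φ : Matrix n n ℂ →ₗ[ℂ] Matrix k k ℂ)

/-- **`Φ(A)⁻¹ ≤ Φ(A⁻¹) ≤ ((M+m)²/(4Mm)) Φ(A)⁻¹`** for `0 < m ≤ A ≤ M` and a positive unital `Φ` — (2) «can be regarded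
as a counterpart to Choi's inequality» (3) (the tree's `PositiveMapKadisonChoiInequalities.choi`).
[cite: Lin2013Kantorovich, (2)–(3), p. 3] -/
theorem inv_map_le_map_inv_le_smul_inv_map (hΦ : ∀ X, X.PosSemidef → (Φ X).PosSemidef) (hΦ1 : Φ 1 = 1)
    {A : Matrix n n ℂ} {m M : ℝ} (hm : 0 < m) (hmM : m ≤ M) (hmA : (A - (m : ℂ) • (1 : Matrix n n ℂ)).PosSemidef)
    (hAM : ((M : ℂ) • (1 : Matrix n n ℂ) - A).PosSemidef) :
    (Φ A⁻¹ - (Φ A)⁻¹).PosSemidef ∧ ((((M + m) ^ 2 / (4 * (M * m)) : ℝ) : ℂ) • (Φ A)⁻¹ - Φ A⁻¹).PosSemidef :=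
  ⟨Literature.LinearAlgebra.Matrix.PositiveMapKadisonChoiInequalities.choi Φ hΦ hΦ1 (posDef_of_sub_smul_one hm hmA),
    map_inv_le_smul_inv_map Φ hΦ hΦ1 hm hmM hmA hAM⟩

end Complex

end Literature.LinearAlgebra.Matrix.PositiveMapKantorovichInequalities
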